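import Summits.ResolutionOfSingularities.ResolutionOfSingularities.Theorems.EquisingularLiftEquisingularLiftNatSubchainSupplierInvDefs
import Summits.ResolutionOfSingularities.ResolutionOfSingularities.Theorems.EquisingularLiftEquisingularLiftNatClusterStepTangentDefs
import HarnessLib

/-!
# [OURS · L1 W4.5(b) · EL♮(3)] HSUB′(ReachTCPlusPlus₂) — THE INVARIANT of the inner chain of rung v7′ (TC⁺⁺) (definitions):
# `TCPlusPlus.Cand` (untracked candidate centres) and `TCPlusPlus.Inv` (ONE `TCPlus.Member` PER SUBSET of the candidates)
# (registered stub `stub_elnat_tcPlusPlusPointResolution` v2, child v14 / parent v16; driver `hsub_reachTCPlusPlus_of_invariant` p543222)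

(α)-2 by res-L1-w45b-stub-3 (res-L1-w45b-plan-1 WORD 2026-08-27T15:07:43Z «(α) NOW: INV″ Defs (Member-per-subset `∀ S ⊆ Cand, TCPlus.Member G T Z S`
over res-L1-w45b-stub-1's `TCPlus.Member` v3 VERBATIM, per TCPP-SUPPLIER-MAP §2) + the driver variant»; res-L1-w45b-lead-2 gave no ONE-MEMBER word by
the 15:40Z default). OURS; NOT a statement of any manuscript; AI-written, weaker than expert review. Definitions only (no theorem); the reviewed
`…Defs` file whose predicate the TC⁺⁺ bricks of the driver (`inv_base″` = (δ) STEP 0 per subset, `inv_step″` = regular step (res-L1-w45b-stub-4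
(A)/(B) pattern) + centred step at a general excluded point (res-L1-w45b-stub-1 (ε)-CORE `member_strictTransform_of_centredPoint_excl`),
`inv_final″` = the curve step from the `∅`-member) share. NO NEW CLAUSES: the member predicate is `TCPlus.Member` (…NatSubchainSupplierInvDefs,
p532383) verbatim; only the bookkeeping over subsets and the exceptional tracker `X` of `ClusterReach` (…NatClusterStepDefs, p531557) is new.

* `TCPlusPlus.Cand G Z X` — the CANDIDATE CENTRES of a stage `(G, T, Z, X)` of the `ClusterReach` closure: the closed points `y` of the reduced
  running curve `V(closure Z)_red` at which that curve is NOT regular and which are NOT in the tracker `X` (the points the closure may still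
  blow up as singular points; the tracker absorbs every exceptional fibre, so new singular points born on exceptional curves never become
  candidates — their regularity is owed by the Δ-criterion of the member centred at the blown-up point, exactly as in rung v7).
* `TCPlusPlus.Inv W G β T Z X` — `G` integral, `T` closed irreducible and not inside `closure Z` (as in `TCPlus.Inv`), and FOR EVERY SUBSET
  `S ⊆ Cand G Z X` a member `TCPlus.Member O k θ P q Y Ch G T Z S`: an upstairs `Ch`-stage with a model square for `(G, T)` and an in-carrier
  pair `(𝓢, K_S)` with exact special fibre `closure Z`, `O`-flat, regular carrier, principal stalks, off the generic points of `Y`, regular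
  quotient stalks of codimension `2` at the special points NOT over `S`, and a `TCPlus.CentredPackage` at every point of `S`. The member with
  `S = ∅` is the one the final curve step consumes; at a singular step at `y ∈ Cand ∖ X` the new member for `S′` is the transform of the old
  member for `S′ ∪ {y}` (centred at `y`); at a regular step every member transforms. (`W`, `β` are binders of the driver, unused here.)

STEP 0 ((δ), res-L1-w45b-stub-3): for each `S ⊆ Cand` = subset of the fat cluster of `CarrierCluster₂`, the cone `Φ_S` of res-L1-w45b-stub-3's
T-CLUSTER-LIFT part 9 (p531761) centred exactly at the lifted sections of `S` and Δ-regular elsewhere, packaged as in res-type-100's `inv_base`.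
-/

set_option linter.dupNamespace false -- mandated namespace `Summit.<Summit>.<Problem>` of this single-conjunct summit
set_option linter.overlappingInstances false -- signatures carry `[IsDomain O] [IsDiscreteValuationRing O]`

noncomputable section

open CategoryTheory CategoryTheory.Limits AlgebraicGeometry TopologicalSpace Topology IsLocalRing
open Literature.AlgebraicGeometry.Resolution
open AlgebraicGeometry.Scheme.IdealSheafData
open Summit.ResolutionOfSingularities.ResolutionOfSingularities.Cruxes.EquisingularLiftNat.Sections

namespace Summit.ResolutionOfSingularities.ResolutionOfSingularities.Cruxes.EquisingularLiftNat.Sections.TCPlusPlus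

variable (O : Type) [CommRing O] [IsDomain O] [IsDiscreteValuationRing O] (k : Type) [Field k] (θ : O →+* k)
  (P : Scheme.{0}) (q : P ⟶ Spec (.of O)) (Y : Set P) (Ch : ∀ X' : Scheme.{0}, (X' ⟶ P) → Set X' → Prop)

/-- **The untracked candidate centres** of a stage `(G, T, Z, X)` of the `ClusterReach` closure: the closed points of the reduced running
curve `V(closure Z)_red` at which it is not regular and which lie outside the exceptional tracker `X`. [OURS · L1 W4.5b] -/
def Cand (G : Scheme.{0}) (Z X : Set G) : Set G :=
  {y : G | IsClosed ({y} : Set G) ∧ y ∉ X ∧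
    ∃ y' : redSub G (closure Z) isClosed_closure, (redSubι G (closure Z) isClosed_closure y' : G) = y ∧
      ¬ IsRegularLocalRing ((redSub G (closure Z) isClosed_closure).presheaf.stalk y')}

/-- **The invariant `INV″ W G β T Z X` of the TC⁺⁺ driver `hsub_reachTCPlusPlus_of_invariant`** (p543222): `G` integral, `T` closed
irreducible and not inside `closure Z`, and ONE `TCPlus.Member` (res-L1-w45b-stub-1, INV DEFS v3 p532383, verbatim) FOR EVERY SUBSET `S` of the
untracked candidate centres, centred exactly at `S`. [OURS · L1 W4.5b] -/
def Inv {F₁ F₂ : Scheme.{0}} (_W : Set F₁) (G : Scheme.{0}) (_β : G ⟶ F₂) (T Z X : Set G) : Prop :=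
  IsIntegral G ∧ IsClosed T ∧ IsIrreducible T ∧ ¬ T ⊆ closure Z ∧
    ∀ S : Set G, S ⊆ Cand G Z X → TCPlus.Member O k θ P q Y Ch G T Z S

end Summit.ResolutionOfSingularities.ResolutionOfSingularities.Cruxes.EquisingularLiftNat.Sections.TCPlusPlus

end
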